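import Literature.AnabelianGeometry.SemiGraphs.TemperedPiDecompositionEdges
import Literature.AnabelianGeometry.SemiGraphs.TemperedPiDecompositionStab
import HarnessLib

/-!
# Stabilisers of compatible edge systems lie in edge decomposition images ([SemiAnbd] §3 p. 41)

Mochizuki, *Semi-graphs of anabelioids*, Publ. RIMS **42** (2006), §3, Thm. 3.7 (iii) and its proof,
author's manuscript p. 41 [cite: MochizukiSemiAnbd2006, Thm 3.7(iii) p.41] ("a compatible system of pairs
of vertices of the `𝒢_{∞,i}` … joined to one another by a single [closed] edge … this compact subgroup is
contained in the image of some `π̂₁(𝒢_e)`"; Comments (2020) (6): "a compatible system of closed edges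
fixed by `H` … `H` is contained in some edge-like subgroup").

Sequel to `TemperedPiDecompositionEdges.lean` (seat abc-iut-L3-t6, row «DECOMP-E»), the TREE HALF of
the identification (I3) of `TemperedLevelData.lean`:

* `EdgeSeq.mem_range_decompHomE_of_fixes` — an element of `π₁^temp(𝒢)` fixing every edge `[t n]`
  lies in the image of the edge decomposition homomorphism at `t` (compactness of `Π_e`);
* `exists_edgeSeq_edge_eq` — every compatible EDGE system of the trees `𝔾̃_n` is the edge system of a
  compatible edge-point sequence, over the common base edge;
* `extendEdge` / `exists_edgeSeq_edge_eq_eventual` — the same for an EVENTUAL compatible edge system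
  (given from a level `j₁` on, as in the field `edge` of `VerticialLevelData`), extended downwards
  along the transition maps;
* `exists_decompHomE_range_of_fixes` — hence the stabiliser of an eventual compatible edge system lies
  in the image of an edge decomposition homomorphism `Π_e → π₁^temp(𝒢)` over the common base edge `e`.

What (I3) still needs is the chart-side statement that these images are EDGE-LIKE subgroups.
Nothing here bears on [IUTchIII] Cor. 3.12.
-/

namespace Literature.AnabelianGeometry.SemiGraphs

namespace ProfiniteSemiGraph

namespace GaloisLevelData

open CategoryTheory Topology
open Literature.GroupTheory.CompactGroupIntersections (exists_mem_forall_of_antitone)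
open Literature.AlgebraicGeometry.Frobenioids.QuasiTemperoid.BTempConnected (ρ_inv_apply)

universe u

variable {𝒢 : ProfiniteSemiGraph.{u}} (D : GaloisLevelData 𝒢) (h𝒢 : 𝒢.IsCountable)

/-- The structure morphism `𝔾̃_n → 𝔾` on an edge `(E, q)` is the base edge of the orbit `E`.
[cite: MochizukiSemiAnbd2006, Thm 3.7(iii) p.41] -/
theorem treeProj_edgeMap (n : ℕ) (x : (D.tree n).Edge) :
    (D.treeProj n).edgeMap x = CovObj.OEdge.base (D.S n) x.1 := rfl

namespace EdgeSeq

variable {D h𝒢} {e : 𝒢.graph.Edge} (T : D.EdgeSeq h𝒢 e) (hc : 𝒢.graph.IsConnected)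

include hc

/-- The fibres of `h ↦ σ_n^h` on `Π_e` are closed. [cite: MochizukiSemiAnbd2006, Thm 3.7(iii) p.41] -/
theorem isClosed_setOf_galE_eq (n : ℕ) (σ : D.Gal h𝒢 n) : IsClosed {h : 𝒢.Ge e | T.galE hc n h = σ} :=
  isClosed_singleton.preimage ((D.continuous_proj h𝒢 n).comp (T.continuous_decompHomE hc))

/-- If `g ∈ π₁^temp` fixes the edge `[t n]` of `𝔾̃_n`, its `n`-th component is some `σ_n^k`, `k ∈ Π_e`.
[cite: MochizukiSemiAnbd2006, Thm 3.7(iii) p.41] -/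
theorem exists_galE_eq_proj_of_fixes (n : ℕ) (g : D.temperedPi h𝒢)
    (hg : (D.treeAct h𝒢 n g).hom.edgeMap (T.edge n) = T.edge n) :
    ∃ k : 𝒢.Ge e, T.galE hc n k = D.proj h𝒢 n g := by
  rw [D.treeAct_apply] at hg
  unfold edge at hg
  rw [D.galTreeAct_edgeMap_mk h𝒢 n] at hg
  obtain ⟨k, hk⟩ := (D.cover h𝒢 n).exists_ρE_of_mk_eq_mk (D.mkE_eq_mkE_of_edgeMap_eq h𝒢 n _ _ hg)
  refine ⟨k, (T.eq_galE hc n k _ ?_).symm⟩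
  have hk' := congrArg (((D.cover h𝒢 n).SE e).obj.ρ k⁻¹) hk
  rw [ρ_inv_apply] at hk'
  exact hk'

/-- **(I3), tree half: an element of `π₁^temp(𝒢)` fixing every edge `[t n]` lies in the image of the edge
decomposition homomorphism at `t`** (compactness of `Π_e`). [cite: MochizukiSemiAnbd2006, Thm 3.7(iii) p.41] -/
theorem mem_range_decompHomE_of_fixes (g : D.temperedPi h𝒢)
    (hg : ∀ n, (D.treeAct h𝒢 n g).hom.edgeMap (T.edge n) = T.edge n) :
    g ∈ (T.decompHomE hc).range := by
  have hanti : ∀ ⦃i j : ℕ⦄, i ≤ j →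
      {k : 𝒢.Ge e | T.galE hc j k = D.proj h𝒢 j g} ⊆ {k : 𝒢.Ge e | T.galE hc i k = D.proj h𝒢 i g} := by
    intro i j hij k hk
    change T.galE hc i k = D.proj h𝒢 i g
    change T.galE hc j k = D.proj h𝒢 j g at hk
    have e1 : D.mapLE h𝒢 hij (T.galE hc j k) = T.galE hc i k :=
      D.mapLE_of_step h𝒢 (fun n => T.galE hc n k) (fun n => T.step_galE hc n k) hij
    rw [← e1, hk, D.mapLE_proj]
  obtain ⟨k, hk⟩ := exists_mem_forall_of_antitone (fun n => {k : 𝒢.Ge e | T.galE hc n k = D.proj h𝒢 n g})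
    hanti (fun n => T.exists_galE_eq_proj_of_fixes hc n g (hg n)) (fun n => T.isClosed_setOf_galE_eq hc n _)
  exact ⟨k, (T.eq_decompHomE hc g k fun n => by
    rw [← (hk n : T.galE hc n k = D.proj h𝒢 n g)]; exact T.galE_apply hc n k).symm⟩

end EdgeSeq

/-! ### Compatible edge-point sequences over a compatible edge system -/

section Existence

variable {D h𝒢} (hc : 𝒢.graph.IsConnected)

/-- A point of the edge fibre of `𝒢_{∞,n}` over a given edge `(E, q)` of `𝔾̃_n` with `E` over `e`.
[cite: MochizukiSemiAnbd2006, Prop 3.6 p.38] -/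
theorem exists_edgePoint_over (n : ℕ) {e : 𝒢.graph.Edge} (x : (D.tree n).Edge)
    (he : CovObj.OEdge.base (D.S n) x.1 = e) :
    ∃ t : ((D.cover h𝒢 n).SE e).obj.V, (D.treeIso h𝒢 n).hom.edgeMap (Quot.mk _ ⟨e, t⟩) = x := by
  subst he
  obtain ⟨E, q⟩ := x
  obtain ⟨y, hy⟩ := CovObj.OEdge.exists_rep (D.S n) E
  exact ⟨⟨⟨E, rfl⟩, ⟨⟨y, hy⟩, q⟩⟩, rfl⟩

/-- The next edge point: over `x (n+1)` and mapping to a given edge point over `treeStep (x (n+1))`.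
[cite: MochizukiSemiAnbd2006, Thm 3.7(iii) p.41] -/
theorem exists_edgePoint_next (n : ℕ) {e : 𝒢.graph.Edge} (x' : (D.tree (n + 1)).Edge)
    (he : CovObj.OEdge.base (D.S (n + 1)) x'.1 = e) (t : ((D.cover h𝒢 n).SE e).obj.V)
    (ht : (D.treeIso h𝒢 n).hom.edgeMap (Quot.mk _ ⟨e, t⟩) = (D.treeStep n).edgeMap x') :
    ∃ t' : ((D.cover h𝒢 (n + 1)).SE e).obj.V,
      (D.treeIso h𝒢 (n + 1)).hom.edgeMap (Quot.mk _ ⟨e, t'⟩) = x' ∧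
        ((D.stepCover h𝒢 n).fE e).hom.hom t' = t := by
  obtain ⟨t₀, ht₀⟩ := exists_edgePoint_over (h𝒢 := h𝒢) (n + 1) x' he
  have h1 : (D.treeIso h𝒢 n).hom.edgeMap (Quot.mk _ ⟨e, ((D.stepCover h𝒢 n).fE e).hom.hom t₀⟩) =
      (D.treeIso h𝒢 n).hom.edgeMap (Quot.mk _ ⟨e, t⟩) := by
    rw [← D.treeStep_edgeMap_mk h𝒢 n, ht₀, ht]
  obtain ⟨k, hk⟩ := (D.cover h𝒢 n).exists_ρE_of_mk_eq_mk (D.mkE_eq_mkE_of_edgeMap_eq h𝒢 n _ _ h1)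
  refine ⟨((D.cover h𝒢 (n + 1)).SE e).obj.ρ k t₀, ?_, ?_⟩
  · rw [← ht₀]
    exact congrArg _ (Quot.sound (CovObj.ERel.mk (S := D.cover h𝒢 (n + 1)) e k t₀)).symm
  · rw [D.stepCover_ρE h𝒢 n, hk]

variable (x : ∀ n, (D.tree n).Edge) (hx : ∀ n, (D.treeStep n).edgeMap (x (n + 1)) = x n)

include hx in
/-- All edges of a compatible edge system lie over the same edge of `𝔾`.
[cite: MochizukiSemiAnbd2006, Thm 3.7(iii) p.41] -/
theorem baseE_eq_of_compatible (n : ℕ) :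
    CovObj.OEdge.base (D.S n) (x n).1 = CovObj.OEdge.base (D.S 0) (x 0).1 := by
  induction n with
  | zero => rfl
  | succ n ih =>
    rw [← ih, ← D.treeProj_edgeMap n, ← D.treeProj_edgeMap (n + 1), ← hx n,
      ← Function.comp_apply (f := (D.treeProj n).edgeMap), ← SemiGraph.comp_edgeMap, D.treeStep_over]

/-- A compatible edge-point sequence over `x`, built by dependent choice. [cite: MochizukiSemiAnbd2006, Thm 3.7(iii) p.41] -/
private noncomputable def seqOverE : ∀ n,
    {t : ((D.cover h𝒢 n).SE (CovObj.OEdge.base (D.S 0) (x 0).1)).obj.V //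
      (D.treeIso h𝒢 n).hom.edgeMap (Quot.mk _ ⟨_, t⟩) = x n}
  | 0 => ⟨(exists_edgePoint_over (h𝒢 := h𝒢) 0 (x 0) rfl).choose,
      (exists_edgePoint_over (h𝒢 := h𝒢) 0 (x 0) rfl).choose_spec⟩
  | n + 1 =>
    ⟨(exists_edgePoint_next (h𝒢 := h𝒢) n (x (n + 1)) (baseE_eq_of_compatible x hx (n + 1)) (seqOverE n).1
        ((seqOverE n).2.trans (hx n).symm)).choose,
      (exists_edgePoint_next (h𝒢 := h𝒢) n (x (n + 1)) (baseE_eq_of_compatible x hx (n + 1)) (seqOverE n).1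
        ((seqOverE n).2.trans (hx n).symm)).choose_spec.1⟩

/-- **A compatible edge-point sequence over the compatible edge system `x`.**
[cite: MochizukiSemiAnbd2006, Thm 3.7(iii) p.41] -/
noncomputable def edgeSeqOver : D.EdgeSeq h𝒢 (CovObj.OEdge.base (D.S 0) (x 0).1) where
  pt n := (seqOverE (h𝒢 := h𝒢) x hx n).1
  compat n := (exists_edgePoint_next (h𝒢 := h𝒢) n (x (n + 1)) (baseE_eq_of_compatible x hx (n + 1))
    (seqOverE (h𝒢 := h𝒢) x hx n).1 ((seqOverE (h𝒢 := h𝒢) x hx n).2.trans (hx n).symm)).choose_spec.2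

/-- The edge system of `edgeSeqOver x` is `x`. [cite: MochizukiSemiAnbd2006, Thm 3.7(iii) p.41] -/
theorem edgeSeqOver_edge (n : ℕ) : (edgeSeqOver (h𝒢 := h𝒢) x hx).edge n = x n :=
  (seqOverE (h𝒢 := h𝒢) x hx n).2

end Existence

/-- **Every compatible edge system of the trees `𝔾̃_n` is the edge system of a compatible edge-point
sequence** over the common base edge. [cite: MochizukiSemiAnbd2006, Thm 3.7(iii) p.41] -/
theorem exists_edgeSeq_edge_eq (x : ∀ n, (D.tree n).Edge)
    (hx : ∀ ⦃i j : ℕ⦄ (h : i ≤ j), (D.treeTrans h).edgeMap (x j) = x i) :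
    ∃ (e : 𝒢.graph.Edge) (T : D.EdgeSeq h𝒢 e), ∀ n, T.edge n = x n := by
  have hx' : ∀ n, (D.treeStep n).edgeMap (x (n + 1)) = x n := fun n => by
    rw [← D.treeTrans_le_succ n]; exact hx (Nat.le_succ n)
  exact ⟨_, edgeSeqOver (h𝒢 := h𝒢) x hx', edgeSeqOver_edge (h𝒢 := h𝒢) x hx'⟩

/-! ### Eventual edge systems -/

section Eventual

variable {D} (j₁ : ℕ) (ε : ∀ j : {j : ℕ // j₁ ≤ j}, (D.tree j.1).Edge)
  (hε : ∀ ⦃i j : {j : ℕ // j₁ ≤ j}⦄ (h : i.1 ≤ j.1), (D.treeTrans h).edgeMap (ε j) = ε i)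

/-- The downward extension of an eventual edge system (given from level `j₁` on) to all levels along
the transition maps. [cite: MochizukiSemiAnbd2006, Thm 3.7(iii) p.41] -/
noncomputable def extendEdge (j : ℕ) : (D.tree j).Edge :=
  (D.treeTrans (le_max_left j j₁)).edgeMap (ε ⟨max j j₁, le_max_right j j₁⟩)

include hε in
/-- The extension agrees with the given system from level `j₁` on. [cite: MochizukiSemiAnbd2006, Thm 3.7(iii) p.41] -/
theorem extendEdge_of_le (j : {j : ℕ // j₁ ≤ j}) : D.extendEdge j₁ ε j.1 = ε j :=
  hε (i := j) (j := ⟨max j.1 j₁, le_max_right j.1 j₁⟩) (le_max_left j.1 j₁)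

include hε in
/-- The extension is a compatible edge system. [cite: MochizukiSemiAnbd2006, Thm 3.7(iii) p.41] -/
theorem extendEdge_compat ⦃i j : ℕ⦄ (h : i ≤ j) :
    (D.treeTrans h).edgeMap (D.extendEdge j₁ ε j) = D.extendEdge j₁ ε i := by
  unfold extendEdge
  have hm : max i j₁ ≤ max j j₁ := max_le_max h le_rfl
  rw [← hε (i := ⟨max i j₁, le_max_right i j₁⟩) (j := ⟨max j j₁, le_max_right j j₁⟩) hm,
    ← Function.comp_apply (f := (D.treeTrans h).edgeMap), ← SemiGraph.comp_edgeMap, D.treeTrans_comp,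
    ← Function.comp_apply (f := (D.treeTrans (le_max_left i j₁)).edgeMap), ← SemiGraph.comp_edgeMap,
    D.treeTrans_comp]

include hε in
/-- **Every eventual compatible edge system is (from level `j₁` on) the edge system of a compatible
edge-point sequence.** [cite: MochizukiSemiAnbd2006, Thm 3.7(iii) p.41] -/
theorem exists_edgeSeq_edge_eq_eventual :
    ∃ (e : 𝒢.graph.Edge) (T : D.EdgeSeq h𝒢 e), ∀ j : {j : ℕ // j₁ ≤ j}, T.edge j.1 = ε j := by
  obtain ⟨e, T, hT⟩ := D.exists_edgeSeq_edge_eq h𝒢 (D.extendEdge j₁ ε) (D.extendEdge_compat j₁ ε hε)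
  exact ⟨e, T, fun j => (hT j.1).trans (D.extendEdge_of_le j₁ ε hε j)⟩

include hε in
/-- **(I3), tree half: the stabiliser in `π₁^temp(𝒢)` of an eventual compatible edge system of the trees
lies in the image of an edge decomposition homomorphism `Π_e → π₁^temp(𝒢)`, `e` the common base edge**
(for connected `𝔾`; what remains for (I3) is that this image is an edge-like subgroup of `e`).
[cite: MochizukiSemiAnbd2006, Thm 3.7(iii) p.41] -/
theorem exists_decompHomE_range_of_fixes (hc : 𝒢.graph.IsConnected) :
    ∃ (e : 𝒢.graph.Edge) (T : D.EdgeSeq h𝒢 e), (∀ j : {j : ℕ // j₁ ≤ j}, T.edge j.1 = ε j) ∧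
      (∀ j : {j : ℕ // j₁ ≤ j}, (D.treeProj j.1).edgeMap (ε j) = e) ∧
      ∀ g : D.temperedPi h𝒢, (∀ j : {j : ℕ // j₁ ≤ j}, (D.treeAct h𝒢 j.1 g).hom.edgeMap (ε j) = ε j) →
        g ∈ (T.decompHomE hc).range := by
  obtain ⟨e, T, hT⟩ := D.exists_edgeSeq_edge_eq_eventual h𝒢 j₁ ε hε
  refine ⟨e, T, hT, fun j => ?_, fun g hg => T.mem_range_decompHomE_of_fixes hc g fun n => ?_⟩
  · rw [← hT j]
    exact (T.pt j.1).1.2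
  · -- fixing the eventual system fixes every `[t n]`: go up to `max n j₁` and transport down
    have hfix : (D.treeAct h𝒢 (max n j₁) g).hom.edgeMap (T.edge (max n j₁)) = T.edge (max n j₁) := by
      rw [hT ⟨max n j₁, le_max_right n j₁⟩]
      exact hg ⟨max n j₁, le_max_right n j₁⟩
    rw [← T.treeTrans_edge (le_max_left n j₁), ← Function.comp_apply (f := (D.treeAct h𝒢 n g).hom.edgeMap),
      ← SemiGraph.comp_edgeMap, ← D.treeTrans_act h𝒢 (le_max_left n j₁) g, SemiGraph.comp_edgeMap,
      Function.comp_apply, hfix]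

end Eventual

end GaloisLevelData

end ProfiniteSemiGraph

end Literature.AnabelianGeometry.SemiGraphs
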